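import Mathlib

/-!
# T4OutputRate — HYPOTHESIS SHAPES for the η-rate (NE5) and the coupling-Lipschitz dependence (NE9) of Bałaban's one-step
output functionals `E^{(j)}(X; g, U)`, with the T4-DAG node-U3 three-bracket decomposition KERNEL-CHECKED (cell `pub-balaban`,
T4-DAG v1 §2 node U3, §5 row T4-U3.E, §6 NE5 + NE9; typing + bookkeeping only)

HONEST FRAMING (T4-DAG v1 PAGE 1).  The cell's T4 target is rung (B)+1: existence AND uniqueness of the ε → 0 limit of
Bałaban's unit-scale averaged expectations on a FIXED finite torus — strictly beyond ultraviolet stability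
([Balaban1988Convergent] Cor. 3 p. 264; [Balaban1989LargeFieldII] Thm 1 p. 355), and NOT infinite volume, NOT a mass gap,
NOT the Clay problem.  Node U3 of the uniqueness spine compares the scale-j terms of the renormalised effective action
produced by two runs of the renormalization group started at lattice spacings ε (run A, K steps) and ε/L (run B, K + 1
steps) and driven by the SAME unit-lattice field V: `E^{(j),A}(X; g^A, U^A_K(V))` versus `E^{(j+1),B}(X; g^B, U^B_{K+1}(V))`.
NOTHING OF THIS COMPARISON IS PRINTED.  What is printed about these terms (read on the ×2 journal-page renders by this
seat; loci certified in the cell record `t4/T4-XREAD-U3.md` §1, GAPS C-pv05g4-5) is UNIFORM in the lattice spacing and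
QUALITATIVE in the coupling:
* [Balaban1987RG1] p. 257 (0.24)–(0.25): *"E^{(j)}(U) = Σ_{X∈D_j} E^{(j)}(X, U), (0.24) where E^{(j)}(X, U) are analytic and
  gauge invariant functions of U, depending on U restricted to X, and satisfying the inequality |E^{(j)}(X, U)| ≤ E₀
  exp(−κd_j(X)), (0.25) with a sufficiently large constant κ."*; p. 259 Theorem 1 and *"the above bound is uniform in the
  lattice spacing ε. This is the essence of the ultraviolet stability concept"*.
* [Balaban1987RG1] p. 263: *"We assume that the function E^{(j)}(X, g_{j−1}, U, J) is defined and analytic on the space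
  U^c_j(X, α₀, α₁), with some positive, absolute constants α₀, α₁ (i.e., constants independent of X and j). It depends on
  the configurations restricted to X, i.e. on (U, J)|_X. It is a C^∞-function of g_{j−1} ∈ [0, γ], (or analytic), with a
  positive, absolute γ. There exists a constant E₀ such that |E^{(j)}(X, g_{j−1}, U, J)| ≤ E₀ exp(−κd_j(X)) (1.18)"*.
* [Balaban1987RG1] p. 256: *"The function E_k depends also on the effective coupling constants g₀, …, g_{k−1}. It is a sum
  of contributions coming from the k successive integrations in the k renormalization transformations."*; p. 298: *"We write
  β_j as explicitly dependent on g_{j−1}, although it depends also on all preceding coupling constants."*; p. 268 (2.13):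
  *"E^{(k+1)}(g_k, U_{k+1}) = log ∫ dμ_{C^{(k)}}(B)χ_k exp[P^{(k)}(g_k, U_{k+1}, B) + {…}]. (2.13) Let us remark that the
  expression under the exponential above vanishes at g_k = 0"* (the coupling enters through `g_kCB` in every term of (2.12)
  and through `E_k(U_k(exp i[g_kCB − hD̃(g_kCB)]V^{(k)})) − E_k(U_k(V^{(k)}))`, hence through ALL preceding couplings).
* [Balaban1987RG1] p. 266: *"Another possibility is to take g_k/γ_kε₁ instead of ε₁, where γ_k = C log(L^kε)^{−1} with C
  sufficiently large. It has the advantage that the functions E^{(j)}, β_j are analytic functions of the effective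
  coupling constants, but it has some disadvantages in perturbative calculations also."* (the "(or analytic)" branch is a
  DIFFERENT small-field cut-off).
* [Balaban1988Convergent] p. 259 (2.27)–(2.28): *"The term E^{(j)}(X, U_k, z) of the last sum has the following
  properties: (i) it depends on U_k restricted to X; (ii) there exists an analytic function E^{(j)}(X, (U, J), z) of the
  variables (U, J) ∈ U^c_j(X, α_{0,j}, α_{1,j}), which is an extension of this term, i.e., the equality (I.1.9) is satisfied;
  (iii) the extended function is invariant with respect to the gauge transformations (I.1.10); (iv) it satisfies the
  inequality (I.1.18)."* and *"α_{0,j} = g_jC₀(log g_j^{−2})^{q₀}, α_{1,j} = g_jC₁(log g_j^{−2})^{q₁}, (2.28) where q₀, q₁ are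
  integers greater than 1, C₀, C₁ are sufficiently large positive numbers."* (tree `B14.alphaJ`; cell GAPS G-t4-U3-2: in
  the [III] spaces the radii SHRINK with g_j, so a Cauchy estimate gives a Lipschitz-in-U constant of order
  E₀/α_{·,j} = O(g_j^{−1}(log g_j^{−2})^{−q}), whereas in the [I] spaces (absolute α₀, α₁) it is O(E₀)).
* [Balaban1988Convergent] p. 260 (2.31): *"|R^{(j)}(X, (U, J))| ≤ g_j^{κ₀} exp(−κd_j(X)). (2.31) Here κ₀ can be chosen
  arbitrarily large, similarly as κ, if the other parameters are fixed properly, as in [I]."* — the only EXPLICIT power of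
  the coupling printed for any of these functionals, and κ₀ is free only UNDER that proviso (v1.1 DOCFIX, cell GAPS
  G-ref2-14 (b): v1 closed the quotation at "arbitrarily large"; sentence completed from the ×2 render of p. 260).
NOT PRINTED anywhere in [Balaban1987RG1], [Balaban1988RG2Cluster], [Balaban1988Convergent] (cell GAPS G-t4-U3-1, located
absence with null-search log): (a) any comparison of `E^{(j)}` built at two lattice spacings (cell NEW ESTIMATE NE5); (b) any
QUANTITATIVE modulus of the dependence of `E^{(j)}(X; ·, U)` on the couplings, let alone jointly in (g₀, …, g_{j−1}) (cell
NEW ESTIMATE NE9; GAPS G-t4-U3-3); (c) the closeness of the two runs' background fields `U^A_K(V)`, `U^B_{K+1}(V)` (cell NEW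
ESTIMATE NE3, node U1b, record `t4/T4-XREAD-U1b.md`).

Accordingly this module ASSERTS NOTHING about Bałaban's functionals: every `def … : Prop` is a HYPOTHESIS SHAPE over
ABSTRACT carriers (to be ASSUMED by the spine's consumers U5b/U6, never used as a fact), and every `theorem` is
kernel-checked real-number bookkeeping about the shapes.  The estimates that would instantiate NE5/NE9 are NOT in print;
the paper-level sketch with every printed input cited by page is the cell record `t4/T4-EST-U3.md`.  Value = typed
hypothesis shapes with exact quantifiers + the kernel-checked decomposition of node U3 into its three located inputs;
NOT summit progress.

## What is typed

(1) CARRIERS AFTER THE PAIRING (`Carriers`).  As in `T4EtaRate` §1 (GAPS G-t4-U1a-2), comparing run A with run B requires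
UNPRINTED conventions, here taken as already applied and recorded as DATA: a common index type `Dom` of localization
domains X with creation step `scale X = j` (run A's step j is paired with run B's step j + 1: the same physical size
L^jε) and tree length `d X = d_j(X) ≥ 0` (in L^jε units, (0.25)); background carriers `BgA`, `BgB` (understood as
ALREADY RESTRICTED to the synchronised small-field / analyticity domains on which the functionals are defined — the
instancer chooses the subtypes); a nonnegative closeness gauge on `BgA` (the sup-quantities of the spaces U^c_j(X, α₀, α₁));
and the background transport `transport : BgB → BgA` (one block averaging, [Balaban1985Averaging]; `T4EtaRate` (C3)).
One more unprinted convention is specific to U3 (cell GAPS G-t4-U3-5): the COUPLING RE-INDEXING — run B has K + 1 couplings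
and its step-0 coupling has no partner under j ↦ j + 1 (tree `T4CouplingMatching.disc` pairs g^A_j with g^B_{j+1}); a
`Functional` below takes the RE-INDEXED sequence, and run B's unpaired first coupling is a datum absorbed into `EB`.

(2) SHAPES.  `DecayBound` = the printed (0.25)/(1.18) form (binder only); `PrefixDependenceOn` = p. 256/p. 298 in words
("depends on g₀, …, g_{j−1}"), typed as a binder; `LipBackground` = the PRINTED-INGREDIENT shape "analytic in U on
U^c_j + Cauchy on a shrunk domain ⇒ Lipschitz in U with constant C_U(g, j)·e^{−κd_j(X)}" with a constant family ALLOWED to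
depend on the coupling sequence and the scale (G-t4-U3-2); `NE9` = JOINT Lipschitz dependence on the preceding couplings
with history moduli `Λ j i`, i < j, on an admissible window W of coupling sequences (typed exactly like
`T4CouplingMatching.HistLipschitz` for the β-functions, node U2, GAPS G-t4-U2-2), plus `FadingMemory` (verbatim the
definition of `T4CouplingMatching.FadingMemory`, restated to keep this module Mathlib-only); `NE5` = the η-rate of the
one-step output AT FIXED (re-indexed, transported) ARGUMENTS with the scale-covariant factor θ^j·e^{−κd_j(X)}, θ ∈ (0, 1),
j = `scale X` — the convention of `T4EtaRate.rateFactor` ((lattice spacing / size of the site)^γ = L^{−γj}, of order one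
at the finest scales and θ^K = ε^γ at the unit scale; King's printed instances [King1986] (3.73) p. 665 and (3.91) p. 669
are the model, and King's p. 665 sentence is the printed MODEL OF THE MECHANISM, for the perturbative functional E_φ of the
U(1) Higgs model in d = 2, 3: *"If we replace such a propagator in E_φ^{(k+n)}(H̃), the error is the same graph with a
difference or propagators on one line. Using the method presented, this error is bounded, and Proposition 3.8 gives the
desired factor L^{−γk}."*); `BackgroundsClose` = the consumer shape of NE3.

(3) BOOKKEEPING (kernel-checked).  `u3_threeBrackets`: NE9 ∧ LipBackground ∧ NE5 ∧ (gauge(U^A, transport U^B) ≤ δ) ⇒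
|EA g^A U^A X − EB g^B U^B X| ≤ (C_U(g^A, j)·δ + Σ_{i<j} Λ j i |g^A_i − g^B_i| + C₅θ^j)·e^{−κd_j(X)} — the T4-DAG node-U3
decomposition "(argument: NE3) + (Lipschitz in U: printed ingredients) + (functional at fixed argument: NE5 + NE9)" by two
triangle inequalities; `u3_geometric`: if moreover the first two brackets are ≤ a·θ^j and ≤ b·θ^j then the carver's target
shape `E₀′θ^j e^{−κd_j(X)}` holds with E₀′ = a + b + C₅; `prefixDependenceOn_of_ne9`: NE9 implies prefix dependence on W;
`historySum_le_of_fadingMemory`: under fading memory Λ j i ≤ C₉ω^{j−i} (ω < 1) and a UNIFORM coupling discrepancy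
|g^A_i − g^B_i| ≤ D the history bracket is ≤ C₉·D·(1 − ω)⁻¹ UNIFORMLY in j (the influence of old couplings does not
accumulate — the structural claim U5b needs; NOT PRINTED, cf. `T4CouplingMatching.FadingMemory` docstring).

(4) NOT TYPED here (cell record `t4/T4-EST-U3.md` §4): the analytic-in-g branch (complex couplings with the alternative
cut-off g_k/γ_kε₁ of p. 266, γ_k = C log(L^kε)^{−1} depending on the number of remaining scales — G-t4-U3-4); Euclidean
covariance ACROSS lattice spacings (only the one-lattice (2.29)/(2.32) are printed — `t4/T4-XREAD-U3.md` §4 T5); the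
R-terms and boundary terms (the same shapes apply verbatim with `E₀ ↦ R₁g_j^{κ₀}`, (2.31)/(2.44)); composition of one-step
pairings over n steps (`T4EtaRate.EtaPairing.comp` is the model; U6 telescopes).

CITATION HEADER (lean-in-tree rule 2026-08-18).  Sources quoted: T. Bałaban, *Renormalization group approach to lattice
gauge field theories. I. Generation of effective actions in a small field approximation and a coupling constant
renormalization in four dimensions*, Commun. Math. Phys. **109**, 249–301 (1987) [Balaban1987RG1] (cell paper B12 = [I];
held `paper:balaban1987-cmp109-rg-i-small-field`, journal page = PDF page + 248; renders `b2b-balaban-ref1/pages/1987-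
cmp109-rg-I-small-field/…-p008/p009/p011/p015/p016/p018/p020/p050-x2.png`); T. Bałaban, *Convergent renormalization
expansions for lattice gauge theories*, Commun. Math. Phys. **119**, 243–285 (1988) [Balaban1988Convergent] (B14 = [III];
held `paper:balaban1988-cmp119-convergent-renormalization`, journal page = PDF page + 242; renders `…/1988-cmp119-
convergent-renormalization/…-p017/p018/p020/p021/p022-x2.png`); T. Bałaban, *Renormalization group approach to lattice
gauge field theories. II*, Commun. Math. Phys. **116**, 1–22 (1988) [Balaban1988RG2Cluster] (B13 = [II]; no numbered
theorem of its own: p. 22 *"The above remark completes the proof of the inductive assumptions for the action A_{k+1},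
hence the proof of Theorem I.3."*); C. King, *The U(1) Higgs model. I. The continuum limit*, Commun. Math. Phys. **102**,
649–677 (1986) [King1986] (PUBLISHED, outside the audited series; the printed model of an η-rate; renders `b2b-balaban-
template/king-renders/1986-cmp102-king-u1-higgs-I-p017-x2.png` (p. 665) and `-p021-x2.png` (p. 669)).  The Bałaban papers are
manuscripts UNDER ADJUDICATION by the audit cell `pub-balaban`: NOTHING printed in them is asserted here.  NEW module of
unit `b2b-balaban-pv05-g4` (SURGE NODE PROVER #05 gen 4; journal claim T4-U3.E 2026-08-18T19:30:17Z); imports Mathlib only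
and modifies nothing.
-/

namespace Literature.MathematicalPhysics.QuantumFieldTheory.Balaban1983to89.T4OutputRate

open scoped BigOperators

/-! ## §1 Carriers (the pairing already applied — DATA, not printed) -/

/-- The carriers of node U3 AFTER the run-A/run-B pairing (UNPRINTED conventions recorded as data, cell GAPS G-t4-U1a-2 and
G-t4-U3-5): localization domains with creation step and tree length ((0.24)–(0.25) p. 257 of [I]); background carriers of the
two runs, understood as already restricted to the domains of definition; a nonnegative closeness gauge on run-A backgrounds
(the sup-quantities of `U^c_j(X, α₀, α₁)`, p. 263 of [I]); the one-step background transport run B → run A.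
[cite: Balaban1987RG1, (0.24)-(0.25) p.257 and §1 p.263] -/
structure Carriers where
  /-- index type of localization domains X ∈ D_j, all creation steps j -/
  Dom : Type
  /-- creation step j of X (run A numbering; paired with run B's step j + 1) -/
  scale : Dom → ℕ
  /-- tree length d_j(X) in L^jε units -/
  d : Dom → ℝ
  d_nonneg : ∀ X, 0 ≤ d X
  /-- run-A backgrounds (spacing ε), restricted to the domain of definition -/
  BgA : Type
  /-- run-B backgrounds (spacing ε/L), restricted likewise -/
  BgB : Type
  /-- closeness gauge on run-A backgrounds -/
  gauge : BgA → BgA → ℝ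
  gauge_nonneg : ∀ U U', 0 ≤ gauge U U'
  /-- background transport run B → run A (one block averaging) -/
  transport : BgB → BgA

/-- A family of one-step output functionals on the carriers: (re-indexed coupling sequence, background, domain X) ↦
`E^{(j)}(X; g, U)` with j = `scale X` ((0.24) p. 257, (1.18) p. 263 of [I]; (2.27) p. 259 of [III]).  Abstract: nothing of
Bałaban's construction (2.13) p. 268 is modelled. [cite: Balaban1987RG1, (2.13) p.268] -/
abbrev Functional (C : Carriers) (Bg : Type) : Type := (ℕ → ℝ) → Bg → C.Dom → ℝ

/-- The admissible window of coupling sequences `]0, γ]^ℕ` (Theorem 1 p. 259 of [I]: *"If the sequence of the effective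
coupling constants is contained in an interval ]0, γ] with a sufficiently small positive γ"*; coordinatewise the box
`FlowStep.Box γ k` of the tree). [cite: Balaban1987RG1, Thm 1 p.259] -/
def Window (γ : ℝ) : Set (ℕ → ℝ) := {g | ∀ i, 0 < g i ∧ g i ≤ γ}

/-- Membership in the window, coordinatewise. [folklore] -/
theorem mem_window {γ : ℝ} {g : ℕ → ℝ} : g ∈ Window γ ↔ ∀ i, 0 < g i ∧ g i ≤ γ := Iff.rfl

variable {C : Carriers}

/-! ## §2 Hypothesis shapes (binders only — nothing asserted) -/

/-- PRINTED FORM (binder only): the decay bound (0.25) p. 257 / (1.18) p. 263 of [I], `|E^{(j)}(X; g, U)| ≤ E₀ e^{−κd_j(X)}`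
for all admissible couplings and all backgrounds of the carrier (uniform in the lattice spacing, p. 259).
[cite: Balaban1987RG1, (1.18) p.263] -/
def DecayBound {Bg : Type} (E : Functional C Bg) (W : Set (ℕ → ℝ)) (E₀ κ : ℝ) : Prop :=
  ∀ g ∈ W, ∀ (U : Bg) (X : C.Dom), |E g U X| ≤ E₀ * Real.exp (-(κ * C.d X))

/-- PRINTED IN WORDS, typed as a binder: the scale-j term depends on the couplings `g₀, …, g_{j−1}` only (p. 256 *"The
function E_k depends also on the effective coupling constants g₀, …, g_{k−1}"*; p. 298), on the window W.
[cite: Balaban1987RG1, §0 p.256 and §5 p.298] -/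
def PrefixDependenceOn {Bg : Type} (E : Functional C Bg) (W : Set (ℕ → ℝ)) : Prop :=
  ∀ g ∈ W, ∀ g' ∈ W, ∀ (U : Bg) (X : C.Dom), (∀ i < C.scale X, g i = g' i) → E g U X = E g' U X

/-- PRINTED-INGREDIENT SHAPE (binder): Lipschitz dependence on the background through the carrier's gauge, with a constant
family `CU g j` ALLOWED to depend on the coupling sequence and the scale — what "analytic on U^c_j(X, α_{0,j}, α_{1,j})"
((2.27)(ii) p. 259 of [III]) plus (I.1.18) plus a Cauchy estimate on a shrunk domain would give, with `CU g j` of order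
`E₀/α_{·,j}`, `α_{·,j} = g_jC(log g_j^{−2})^q` (2.28) (tree `B14.alphaJ`; cell GAPS G-t4-U3-2); in the spaces of [I]
(absolute α₀, α₁, p. 263) the constant would be O(E₀).  The Cauchy step itself is NOT carried out here.
[cite: Balaban1988Convergent, (2.27)-(2.28) p.259] -/
def LipBackground (E : Functional C C.BgA) (W : Set (ℕ → ℝ)) (κ : ℝ) (CU : (ℕ → ℝ) → ℕ → ℝ) : Prop :=
  ∀ g ∈ W, ∀ (U U' : C.BgA) (X : C.Dom),
    |E g U X - E g U' X| ≤ CU g (C.scale X) * Real.exp (-(κ * C.d X)) * C.gauge U U'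

/-- HYPOTHESIS SHAPE NE9 (cell NEW ESTIMATE, NOT PRINTED; GAPS G-t4-U3-3): JOINT Lipschitz dependence of the scale-j term on
the preceding couplings, with HISTORY MODULI `Λ j i` (the influence of `g_i`, `i < j`, on `E^{(j)}(X; ·, U)`), times the
printed decay factor, on the window W.  Print gives only *"It is a C^∞-function of g_{j−1} ∈ [0, γ], (or analytic)"* (p. 263
of [I]) — of the LAST coupling, qualitatively — and that the dependence on the earlier ones exists (pp. 256, 298).  Typed
exactly like the tree's `T4CouplingMatching.HistLipschitz` for the β-functions. [cite: Balaban1987RG1, §1 p.263 and §5 p.298] -/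
def NE9 {Bg : Type} (E : Functional C Bg) (W : Set (ℕ → ℝ)) (κ : ℝ) (Λ : ℕ → ℕ → ℝ) : Prop :=
  ∀ g ∈ W, ∀ g' ∈ W, ∀ (U : Bg) (X : C.Dom),
    |E g U X - E g' U X| ≤
      Real.exp (-(κ * C.d X)) * ∑ i ∈ Finset.range (C.scale X), Λ (C.scale X) i * |g i - g' i|

/-- HYPOTHESIS SHAPE (NOT PRINTED): FADING MEMORY of the history moduli, `0 ≤ Λ k i ≤ C₉ ω^{k−i}` for `i ≤ k` — verbatim
the definition `T4CouplingMatching.FadingMemory` of the tree (node U2), restated so that this module imports Mathlib only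
(the two are definitionally equal). [cite: Balaban1987RG1, §5 p.298] -/
def FadingMemory (C₉ ω : ℝ) (Λ : ℕ → ℕ → ℝ) : Prop :=
  ∀ k i, i ≤ k → 0 ≤ Λ k i ∧ Λ k i ≤ C₉ * ω ^ (k - i)

/-- HYPOTHESIS SHAPE NE5 (cell NEW ESTIMATE, NOT PRINTED; GAPS G-t4-U3-1): the η-RATE of the one-step output functional AT
FIXED ARGUMENTS — the same re-indexed coupling sequence, and the run-B background seen by run A through the transport —
with the scale-covariant factor `θ^j`, `j = scale X` (convention of `T4EtaRate.rateFactor`: (spacing/size)^γ = L^{−γj};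
printed model [King1986] (3.73) p. 665 *"≤ CL^{−γk}{(L^jη)^{2−d−γ}, (L^jη)^{1−d−γ}} exp[−δ₀(L^jη)^{−1}|x − y|]"*), times
the printed decay factor of (0.25).  Print has only the UNIFORMITY: p. 259 of [I] *"the above bound is uniform in the
lattice spacing ε"*. [cite: Balaban1987RG1, Thm 1 p.259] -/
def NE5 (EA : Functional C C.BgA) (EB : Functional C C.BgB) (W : Set (ℕ → ℝ)) (κ θ C₅ : ℝ) : Prop :=
  ∀ g ∈ W, ∀ (U : C.BgB) (X : C.Dom),
    |EA g (C.transport U) X - EB g U X| ≤ C₅ * θ ^ C.scale X * Real.exp (-(κ * C.d X))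

/-- CONSUMER SHAPE of NE3 (node U1b, NOT PRINTED; record `t4/T4-XREAD-U1b.md`): the two runs' background fields driven by
the same unit-lattice data `v` are δ-close in run A's gauge after transporting run B's. [cite: Balaban1987RG1, (0.21)-(0.22) p.256] -/
def BackgroundsClose {V : Type} (uA : V → C.BgA) (uB : V → C.BgB) (δ : ℝ) : Prop :=
  ∀ v, C.gauge (uA v) (C.transport (uB v)) ≤ δ

/-! ## §3 Bookkeeping (kernel-checked) -/

/-- NODE U3, THREE BRACKETS (T4-DAG v1 §2 U3): NE9 on run A + Lipschitz-in-U on run A + NE5, and δ-closeness of the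
backgrounds, give the bound on the difference of the two runs' scale-j terms with every located input visible:
(C_U(g^A, j)·δ) [argument bracket: NE3 × printed Lipschitz-in-U] + (Σ_{i<j} Λ j i |g^A_i − g^B_i|) [coupling bracket: NE9 ×
node U2's coupling matching] + (C₅θ^j) [functional bracket: NE5], all times e^{−κd_j(X)}.  Two triangle inequalities.
[folklore] -/
theorem u3_threeBrackets {W : Set (ℕ → ℝ)} {EA : Functional C C.BgA} {EB : Functional C C.BgB}
    {κ θ C₅ : ℝ} {Λ : ℕ → ℕ → ℝ} {CU : (ℕ → ℝ) → ℕ → ℝ}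
    (h9 : NE9 EA W κ Λ) (hU : LipBackground EA W κ CU) (h5 : NE5 EA EB W κ θ C₅)
    {gA gB : ℕ → ℝ} (hgA : gA ∈ W) (hgB : gB ∈ W)
    {UA : C.BgA} {UB : C.BgB} {δ : ℝ} (hδ : C.gauge UA (C.transport UB) ≤ δ)
    (X : C.Dom) (hCU : 0 ≤ CU gA (C.scale X)) :
    |EA gA UA X - EB gB UB X| ≤
      (CU gA (C.scale X) * δ
        + (∑ i ∈ Finset.range (C.scale X), Λ (C.scale X) i * |gA i - gB i|)
        + C₅ * θ ^ C.scale X) * Real.exp (-(κ * C.d X)) := by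
  have he : 0 < Real.exp (-(κ * C.d X)) := Real.exp_pos _
  have h1 : |EA gA UA X - EA gA (C.transport UB) X| ≤
      CU gA (C.scale X) * Real.exp (-(κ * C.d X)) * C.gauge UA (C.transport UB) :=
    hU gA hgA UA (C.transport UB) X
  have h1' : CU gA (C.scale X) * Real.exp (-(κ * C.d X)) * C.gauge UA (C.transport UB) ≤
      CU gA (C.scale X) * Real.exp (-(κ * C.d X)) * δ :=
    mul_le_mul_of_nonneg_left hδ (mul_nonneg hCU he.le)
  have h2 : |EA gA (C.transport UB) X - EA gB (C.transport UB) X| ≤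
      Real.exp (-(κ * C.d X)) * ∑ i ∈ Finset.range (C.scale X), Λ (C.scale X) i * |gA i - gB i| :=
    h9 gA hgA gB hgB (C.transport UB) X
  have h3 : |EA gB (C.transport UB) X - EB gB UB X| ≤ C₅ * θ ^ C.scale X * Real.exp (-(κ * C.d X)) :=
    h5 gB hgB UB X
  have t1 := abs_sub_le (EA gA UA X) (EA gA (C.transport UB) X) (EB gB UB X)
  have t2 := abs_sub_le (EA gA (C.transport UB) X) (EA gB (C.transport UB) X) (EB gB UB X)
  have eq : (CU gA (C.scale X) * δ
        + (∑ i ∈ Finset.range (C.scale X), Λ (C.scale X) i * |gA i - gB i|)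
        + C₅ * θ ^ C.scale X) * Real.exp (-(κ * C.d X))
      = CU gA (C.scale X) * Real.exp (-(κ * C.d X)) * δ
        + Real.exp (-(κ * C.d X)) * (∑ i ∈ Finset.range (C.scale X), Λ (C.scale X) i * |gA i - gB i|)
        + C₅ * θ ^ C.scale X * Real.exp (-(κ * C.d X)) := by ring
  rw [eq]
  linarith

/-- The carver's TARGET SHAPE for node U3 (T4-DAG v1 §2: `|E^{(j),A} − E^{(j+1),B}| ≤ E₀′θ^j e^{−κd_j(X)}`) follows from the
three brackets as soon as the argument bracket and the coupling bracket are themselves ≤ a·θ^j and ≤ b·θ^j at the scale of X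
(what NE3 + node U2's coupling matching must deliver); then E₀′ = a + b + C₅. [folklore] -/
theorem u3_geometric {W : Set (ℕ → ℝ)} {EA : Functional C C.BgA} {EB : Functional C C.BgB}
    {κ θ C₅ : ℝ} {Λ : ℕ → ℕ → ℝ} {CU : (ℕ → ℝ) → ℕ → ℝ}
    (h9 : NE9 EA W κ Λ) (hU : LipBackground EA W κ CU) (h5 : NE5 EA EB W κ θ C₅)
    {gA gB : ℕ → ℝ} (hgA : gA ∈ W) (hgB : gB ∈ W)
    {UA : C.BgA} {UB : C.BgB} {δ : ℝ} (hδ : C.gauge UA (C.transport UB) ≤ δ)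
    (X : C.Dom) (hCU : 0 ≤ CU gA (C.scale X)) {a b : ℝ}
    (ha : CU gA (C.scale X) * δ ≤ a * θ ^ C.scale X)
    (hb : (∑ i ∈ Finset.range (C.scale X), Λ (C.scale X) i * |gA i - gB i|) ≤ b * θ ^ C.scale X) :
    |EA gA UA X - EB gB UB X| ≤ (a + b + C₅) * θ ^ C.scale X * Real.exp (-(κ * C.d X)) := by
  have h := u3_threeBrackets h9 hU h5 hgA hgB hδ X hCU
  have he : 0 < Real.exp (-(κ * C.d X)) := Real.exp_pos _
  have hsum : CU gA (C.scale X) * δ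
        + (∑ i ∈ Finset.range (C.scale X), Λ (C.scale X) i * |gA i - gB i|)
        + C₅ * θ ^ C.scale X ≤ (a + b + C₅) * θ ^ C.scale X := by nlinarith
  calc |EA gA UA X - EB gB UB X|
      ≤ (CU gA (C.scale X) * δ
          + (∑ i ∈ Finset.range (C.scale X), Λ (C.scale X) i * |gA i - gB i|)
          + C₅ * θ ^ C.scale X) * Real.exp (-(κ * C.d X)) := h
    _ ≤ (a + b + C₅) * θ ^ C.scale X * Real.exp (-(κ * C.d X)) :=
        mul_le_mul_of_nonneg_right hsum he.le

/-- NE9 implies the printed-in-words prefix dependence on the window: couplings agreeing below the creation step give the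
same term (the history sum vanishes). [folklore] -/
theorem prefixDependenceOn_of_ne9 {Bg : Type} {E : Functional C Bg} {W : Set (ℕ → ℝ)} {κ : ℝ} {Λ : ℕ → ℕ → ℝ}
    (h9 : NE9 E W κ Λ) : PrefixDependenceOn E W := by
  intro g hg g' hg' U X hagree
  have h := h9 g hg g' hg' U X
  have hsum : ∑ i ∈ Finset.range (C.scale X), Λ (C.scale X) i * |g i - g' i| = 0 := by
    refine Finset.sum_eq_zero fun i hi => ?_
    rw [Finset.mem_range] at hi
    simp [hagree i hi]
  rw [hsum, mul_zero] at h
  exact sub_eq_zero.mp (abs_nonpos_iff.mp h)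

/-- The instance "uniform coordinatewise modulus" `Λ ≡ ℓ`: the history bracket is `ℓ · Σ_{i<j} |g^A_i − g^B_i|`, which
GROWS with j unless the discrepancies are summable — recorded to make GAPS G-t4-U3-3 precise (a constant modulus has no
fading memory; compare `T4CouplingMatching.histLipschitz_of_coordLipschitz`). [folklore] -/
theorem historySum_const (ℓ : ℝ) (gA gB : ℕ → ℝ) (j : ℕ) :
    ∑ i ∈ Finset.range j, (fun _ _ => ℓ) j i * |gA i - gB i| = ℓ * ∑ i ∈ Finset.range j, |gA i - gB i| := by
  rw [Finset.mul_sum]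

/-- Under FADING MEMORY `Λ j i ≤ C₉ω^{j−i}` (0 ≤ ω < 1) and a UNIFORM coupling discrepancy `|g^A_i − g^B_i| ≤ D`, the history
bracket is bounded UNIFORMLY IN THE CREATION STEP j: `Σ_{i<j} Λ j i |g^A_i − g^B_i| ≤ C₉·D·(1 − ω)⁻¹` (indeed ≤ C₉Dω(1 − ω)⁻¹;
the weaker constant is recorded).  The structural input U5b needs so that history dependence does not accumulate over
scales; NOT PRINTED. [folklore] -/
theorem historySum_le_of_fadingMemory {C₉ ω : ℝ} {Λ : ℕ → ℕ → ℝ} (hΛ : FadingMemory C₉ ω Λ)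
    (hω0 : 0 ≤ ω) (hω1 : ω < 1) {gA gB : ℕ → ℝ} {D : ℝ} (hD : ∀ i, |gA i - gB i| ≤ D) (j : ℕ) :
    ∑ i ∈ Finset.range j, Λ j i * |gA i - gB i| ≤ C₉ * D * (1 - ω)⁻¹ := by
  have hD0 : 0 ≤ D := (abs_nonneg _).trans (hD 0)
  have hC9 : 0 ≤ C₉ := by
    have h00 := hΛ 0 0 le_rfl
    have := h00.1.trans h00.2
    simpa using this
  -- termwise bound by C₉ D ω^{j-i}, then the geometric tail
  have step : ∀ i ∈ Finset.range j, Λ j i * |gA i - gB i| ≤ C₉ * D * ω ^ (j - i) := by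
    intro i hi
    rw [Finset.mem_range] at hi
    obtain ⟨h0, h1⟩ := hΛ j i hi.le
    calc Λ j i * |gA i - gB i| ≤ (C₉ * ω ^ (j - i)) * D :=
          mul_le_mul h1 (hD i) (abs_nonneg _) (h0.trans h1)
      _ = C₉ * D * ω ^ (j - i) := by ring
  have hgeomHas : HasSum (fun n : ℕ => ω ^ n) (1 - ω)⁻¹ := hasSum_geometric_of_lt_one hω0 hω1
  have hrefl : ∑ i ∈ Finset.range j, ω ^ (j - i) = ∑ m ∈ Finset.range j, ω ^ (m + 1) := by
    rw [← Finset.sum_range_reflect (fun m => ω ^ (m + 1)) j]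
    refine Finset.sum_congr rfl fun i hi => ?_
    rw [Finset.mem_range] at hi
    congr 1
    omega
  have htail : ∑ m ∈ Finset.range j, ω ^ (m + 1) ≤ (1 - ω)⁻¹ := by
    have hle : ∑ m ∈ Finset.range j, ω ^ (m + 1) ≤ ∑ m ∈ Finset.range j, ω ^ m := by
      refine Finset.sum_le_sum fun m _ => ?_
      rw [pow_succ]
      exact mul_le_of_le_one_right (pow_nonneg hω0 _) hω1.le
    exact hle.trans (sum_le_hasSum _ (fun n _ => pow_nonneg hω0 n) hgeomHas)
  calc ∑ i ∈ Finset.range j, Λ j i * |gA i - gB i|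
      ≤ ∑ i ∈ Finset.range j, C₉ * D * ω ^ (j - i) := Finset.sum_le_sum step
    _ = C₉ * D * ∑ i ∈ Finset.range j, ω ^ (j - i) := by rw [Finset.mul_sum]
    _ = C₉ * D * ∑ m ∈ Finset.range j, ω ^ (m + 1) := by rw [hrefl]
    _ ≤ C₉ * D * (1 - ω)⁻¹ := mul_le_mul_of_nonneg_left htail (mul_nonneg hC9 hD0)

end Literature.MathematicalPhysics.QuantumFieldTheory.Balaban1983to89.T4OutputRate
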